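import Summits.QuantumFields.BalabanUV.T4Continuum.Support.RegionLocalBudgets
import Summits.QuantumFields.BalabanUV.T4Continuum.Support.StarCarrierComponents

/-!
# T⁴ programme, spine node NE2 (U1a), sub-row Δ1 «NE2⁰-Dirichlet» — THE ELECTRIC DICTIONARY, BUDGET SIDE: the per-component scalar budgets of
# (P-gaffney) (`‖∂_μ z_ν‖²`, `Σ_{x ∈ T_ν} ‖P_μ z_ν (x)‖²`, the masked Neumann gradient) are dominated by the local form and the directional Hessian

NE2 formalisation swarm `b2b-balaban-t4-ne2-formalise-*`, LEAF PROVER 02 (gen 8), supplier item «Δ1-LOC-HESS» = (R-loc), file 5 (OFFER «ELECTRIC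
DICTIONARY», journal 2026-08-20 l.≈22729; leaf-01-g10's answer l.≈22760: «(D1)+(D2) NOT NEEDED AS NEW FILINGS — P4a HAS THEM, please IMPORT;
(D3)–(D5): TAKE them, they are yours (budget side)»).  Accordingly the POINTWISE dictionary is IMPORTED BY NAME from leaf-01-g10's P4a
`Support/StarCarrierComponents` (p239836: `zext ν u` = the zero-extended component `z_ν`, `Wdir_mulVec_apply_of_ne` — the transverse piece `W_μ`,
`μ ≠ ν`, IS gan24's `Pdir_μ` of `z_ν` —, `Wdir_mulVec_apply_self` — the Neumann stencil), and THIS FILE proves only the budget-side sums (D3)–(D5)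
that plug leaf-03-g8's per-component `budgetOn (starSite ν) n μ z_ν = ‖∂_μ z_ν‖² + Σ_{x ∈ starSite ν} ‖P_μ z_ν (x)‖²` («W3-GAFFNEY-PAIRING» P2,
`AlignedCarrierPairing`) into the owner's O15-c master budget `Ebud` (form + directional Hessian) — the seam «budgetOn_{T_ν} μ z_ν ≤ … ≤ Ebud» of
their plan (l.22541) as theorems:

 * §1 (any region) `sum_starSite_eq` (re-indexing `Σ_{x ∈ starSite ν} g(x,ν) = Σ_{b : V, b.2 = ν} g b`), **`sum_starSite_Pdir_sq_le`**
   (`Σ_{x ∈ starSite ν} ‖P_μ z_ν (x)‖² ≤ ‖W_μ v‖²`, `μ ≠ ν`); the component cut-off `cutComp`, `ext_cutComp_apply`, `fdiff_ext_cutComp`,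
   `nsq_fdiff_ext_cutComp`, `igrad_cutComp`, **`nsq_sdiff_zext_le`** (`‖∂_μ z_ν‖² ≤ ‖igrad_μ v‖² + n²·Σ_b tcnt μ b‖v b‖²`, `μ ≠ ν`: gen 7's
   `nsq_fdiff_ext_eq` on the cut-off field — on component `ν ≠ μ` the per-direction charge `cnt1 μ` IS the transverse charge `tcnt μ`), and the
   own-direction masked gradient **`sum_mask_sdiff_zext_le`** (`Σ_x [x, x+e_ν ∈ starSite ν]·‖∂_ν z_ν (x)‖² ≤ ‖igrad_ν v‖²`).
 * §2 under H1 (`0 ≤ a`): `dir_le_form_loc` (one direction of the electric form ≤ the local form), **`budget_transverse_le`**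
   (`‖∂_μ z_ν‖² + Σ_{x ∈ starSite ν} ‖P_μ z_ν (x)‖² ≤ re⟨v, Δ_loc v⟩ + ‖W_μ v‖²`, `μ ≠ ν` — a sub-sum of `Ebud`), **`budget_own_le`** (the Neumann
   analogue `≤ re⟨v, Δ_loc v⟩`, via the owner's `interiorW2_loc`).
 In the currencies of record (not imported here, to keep this file's closure small while the farm rebuilds): the left-hand side of
 `budget_transverse_le` IS `AlignedCarrierPairing.budgetOn n M (starSite n M S ν) μ (zext n M S ν v)` (p239673, `unfold budgetOn`), and its
 right-hand side is a sub-sum of `RegionLocalInjectedAssembly.Ebud n M a S v = nsq v + re⟨v, Δ_loc v⟩ + Σ_μ nsq (Wdir μ v) + nsq (Δ_loc v)`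
 (p239590, `unfold Ebud` + `single_le_sum` + `nsq_nonneg`), so `budgetOn (starSite ν) μ z_ν ≤ Ebud v` for `μ ≠ ν` is a three-line corollary
 for the consumer (leaf-03-g8 P5 / the owner).

HONEST FRAMING (T4-DAG p. 1).  Dictionary / bookkeeping at MODEL level (`U = 1`, ONE region, finite torus); [folklore]; nothing printed is a
hypothesis; nothing analytic ((P-gaffney)'s pairings are leaf-03-g8's / leaf-01-g10's); (L) / `hinjK` / W3 on boxes OPEN; NE2 (U1a) NOT proved; spine
PROVED 0/9 unchanged; NOT [B9] (3.16)/(3.23)–(3.27) as printed; NOT infinite volume, NOT a mass gap, NOT the Clay problem.  HONEST DEPENDENCY: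
continuum YM on T⁴ ⇐ BetaPertH ∧ nine spine estimates (0/9 proved); BetaPertH ⇐ (D1) ∧ (D4) ∧ CAP+tail; G-an2-4 gates asym, D1 and NE2/3/4.
No `sorry`.
-/

noncomputable section

open scoped BigOperators ComplexConjugate Matrix Matrix.Norms.L2Operator
open Finset

namespace Summit.QuantumFields.BalabanUV.T4Continuum.RegionElectricDictionary

open Literature.MathematicalPhysics.QuantumFieldTheory.Balaban1983to89.B5Prop11Plancherel (Tor fine fdiff unitVec)
open Literature.MathematicalPhysics.QuantumFieldTheory.Balaban1983to89.B5Prop11Lower (nsq nsq_nonneg)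
open Literature.MathematicalPhysics.QuantumFieldTheory.Balaban1983to89.B5Action121 (sdiff sdiff_mulVec)
open Literature.MathematicalPhysics.QuantumFieldTheory.Balaban1983to89.B5G183FreeRowSum (fdiff_mulVec)
open Summit.QuantumFields.BalabanUV.T4Continuum
open Summit.QuantumFields.BalabanUV.T4Continuum.SubtypeCompression (ext_apply_of ext_apply_of_not nsq_ext)
open Summit.QuantumFields.BalabanUV.T4Continuum.RegionGaugeFixedVector (starReg avgR)
open Summit.QuantumFields.BalabanUV.T4Continuum.DirichletStarRenormTower (igrad)
open Summit.QuantumFields.BalabanUV.T4Continuum.RegionStarBoundaryCharges (AtMostOneNeighbour nsq_fdiff_ext_eq)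
open Summit.QuantumFields.BalabanUV.T4Continuum.RegionElectricSplitting (tcnt tcnt_nonneg Wdir)
open Summit.QuantumFields.BalabanUV.T4Continuum.RegionElectricCommutation (igrad_apply)
open Summit.QuantumFields.BalabanUV.T4Continuum.RegionGaugeResolventSplit (regionDeltaLoc)
open Summit.QuantumFields.BalabanUV.T4Continuum.RegionLocalBudgets (form_regionDeltaLoc_electric)
open Summit.QuantumFields.BalabanUV.T4Continuum.RegionLocalInjectedPairing (interiorW2_loc)
open Summit.QuantumFields.BalabanUV.T4Continuum.AlignedCarrierTrace (starSite)
open Summit.QuantumFields.BalabanUV.T4Continuum.StarCarrierComponents (zext zext_apply_of zext_apply_of_not Wdir_mulVec_apply_of_ne)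
open Summit.QuantumFields.BalabanUV.Beta.GAN24.DirichletBoxRegularity (Pdir)

variable {d : ℕ}

section Region

variable (n : ℕ) [NeZero n] (M : Fin d → ℕ) [hM : ∀ μ, NeZero (M μ)] (S : Tor M → Prop) [DecidablePred S]

/-! ## §1 The per-component scalar budgets against `‖W_μ v‖²`, `‖igrad_μ v‖²` and the transverse charges (any region) -/

/-- re-indexing: a sum over the star sites of component `ν` is the component-`ν` part of a sum over the star bonds. [folklore] -/
theorem sum_starSite_eq (ν : Fin d) (g : Tor (fine n M) × Fin d → ℝ) :
    ∑ x ∈ univ.filter (starSite n M S ν), g (x, ν) = ∑ b : {b // starReg n M S b}, (if b.1.2 = ν then g b.1 else 0) := by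
  have h1 : ∑ b : {b // starReg n M S b}, (if b.1.2 = ν then g b.1 else 0)
      = ∑ c : Tor (fine n M) × Fin d, (if starReg n M S c ∧ c.2 = ν then g c else 0) := by
    rw [← Fintype.sum_subtype_add_sum_subtype (starReg n M S) (fun c : Tor (fine n M) × Fin d => if starReg n M S c ∧ c.2 = ν then g c else 0)]
    have h0 : ∑ c : {c // ¬ starReg n M S c}, (if starReg n M S c.1 ∧ c.1.2 = ν then g c.1 else 0) = 0 :=
      sum_eq_zero fun c _ => by rw [if_neg (fun h => c.2 h.1)]
    rw [h0, add_zero]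
    exact sum_congr rfl fun b _ => by simp only [b.2, true_and]
  rw [h1, Fintype.sum_prod_type, sum_filter]
  refine sum_congr rfl fun x _ => ?_
  rw [Finset.sum_eq_single ν (fun ν' _ hne => if_neg (fun h => hne h.2)) (fun h => absurd (mem_univ _) h)]
  by_cases hx : starSite n M S ν x
  · rw [if_pos hx, if_pos ⟨hx, rfl⟩]
  · rw [if_neg hx, if_neg (fun h => hx h.1)]

/-- **`Σ_{x ∈ starSite ν} ‖P_μ z_ν (x)‖² ≤ ‖W_μ v‖²`** for `μ ≠ ν` (any region): the interior `Pdir` budget of the component is a sub-sum of the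
directional Hessian (leaf-01-g10's `Wdir_mulVec_apply_of_ne` summed). [folklore] -/
theorem sum_starSite_Pdir_sq_le {μ ν : Fin d} (hμν : μ ≠ ν) (v : {b // starReg n M S b} → ℂ) :
    ∑ x ∈ univ.filter (starSite n M S ν), ‖(Pdir (fine n M) (n : ℂ) μ *ᵥ zext n M S ν v) x‖ ^ 2 ≤ nsq (Wdir n M S μ *ᵥ v) := by
  have h1 : ∑ x ∈ univ.filter (starSite n M S ν), ‖(Pdir (fine n M) (n : ℂ) μ *ᵥ zext n M S ν v) x‖ ^ 2
      = ∑ x ∈ univ.filter (starSite n M S ν), ‖SubtypeCompression.ext (starReg n M S) (Wdir n M S μ *ᵥ v) (x, ν)‖ ^ 2 :=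
    sum_congr rfl fun x hx => by
      have hx' : starReg n M S (x, ν) := (mem_filter.mp hx).2
      rw [show SubtypeCompression.ext (starReg n M S) (Wdir n M S μ *ᵥ v) (x, ν) = (Wdir n M S μ *ᵥ v) ⟨(x, ν), hx'⟩ from
        ext_apply_of _ _ ⟨(x, ν), hx'⟩, Wdir_mulVec_apply_of_ne n M S hμν v hx']
  rw [h1, ← nsq_ext (starReg n M S) (Wdir n M S μ *ᵥ v)]
  unfold nsq
  rw [Fintype.sum_prod_type]
  calc ∑ x ∈ univ.filter (starSite n M S ν), ‖SubtypeCompression.ext (starReg n M S) (Wdir n M S μ *ᵥ v) (x, ν)‖ ^ 2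
      ≤ ∑ x, ‖SubtypeCompression.ext (starReg n M S) (Wdir n M S μ *ᵥ v) (x, ν)‖ ^ 2 :=
        sum_le_sum_of_subset_of_nonneg (filter_subset _ _) fun _ _ _ => sq_nonneg _
    _ ≤ ∑ x, ∑ ν', ‖SubtypeCompression.ext (starReg n M S) (Wdir n M S μ *ᵥ v) (x, ν')‖ ^ 2 :=
        sum_le_sum fun x _ => single_le_sum (f := fun ν' => ‖SubtypeCompression.ext (starReg n M S) (Wdir n M S μ *ᵥ v) (x, ν')‖ ^ 2)
          (fun _ _ => sq_nonneg _) (mem_univ ν)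

/-- THE COMPONENT CUT-OFF: keep component `ν`, zero on the other components. [folklore] -/
def cutComp (ν : Fin d) (v : {b // starReg n M S b} → ℂ) : {b // starReg n M S b} → ℂ :=
  fun b => if b.1.2 = ν then v b else 0

/-- the zero extension of the cut-off field is the zero-extended component on component `ν`, zero elsewhere. [folklore] -/
theorem ext_cutComp_apply (ν : Fin d) (v : {b // starReg n M S b} → ℂ) (y : Tor (fine n M)) (ν' : Fin d) :
    SubtypeCompression.ext (starReg n M S) (cutComp n M S ν v) (y, ν') = if ν' = ν then zext n M S ν v y else 0 := by
  unfold cutComp SubtypeCompression.ext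
  by_cases hy : starReg n M S (y, ν')
  · by_cases h : ν' = ν
    · subst h
      simp only [dif_pos hy, if_true, zext_apply_of n M S ν' v hy]
    · simp only [dif_pos hy, h, if_false]
  · by_cases h : ν' = ν
    · subst h
      simp only [dif_neg hy, if_true, zext_apply_of_not n M S ν' v hy]
    · simp only [dif_neg hy, h, if_false]

/-- the torus gradient of the cut-off zero extension is the scalar gradient of the component, on component `ν` only. [folklore] -/
theorem fdiff_ext_cutComp (μ ν : Fin d) (v : {b // starReg n M S b} → ℂ) (y : Tor (fine n M)) (ν' : Fin d) :
    (fdiff (fine n M) (n : ℂ) μ *ᵥ SubtypeCompression.ext (starReg n M S) (cutComp n M S ν v)) (y, ν')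
      = if ν' = ν then (sdiff (fine n M) (n : ℂ) μ *ᵥ zext n M S ν v) y else 0 := by
  rw [fdiff_mulVec, sdiff_mulVec, ext_cutComp_apply, ext_cutComp_apply]
  split_ifs <;> ring

/-- hence `‖∇_μ ι(cutComp ν v)‖² = ‖∂_μ z_ν‖²`. [folklore] -/
theorem nsq_fdiff_ext_cutComp (μ ν : Fin d) (v : {b // starReg n M S b} → ℂ) :
    nsq (fdiff (fine n M) (n : ℂ) μ *ᵥ SubtypeCompression.ext (starReg n M S) (cutComp n M S ν v))
      = nsq (sdiff (fine n M) (n : ℂ) μ *ᵥ zext n M S ν v) := by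
  unfold nsq
  rw [Fintype.sum_prod_type]
  refine sum_congr rfl fun y _ => ?_
  rw [Finset.sum_eq_single ν (fun ν' _ hne => by rw [fdiff_ext_cutComp, if_neg hne, norm_zero, zero_pow two_ne_zero])
    (fun h => absurd (mem_univ _) h), fdiff_ext_cutComp, if_pos rfl]

/-- the interior difference of the cut-off field is the cut-off of the interior difference (`igrad` stays in the component). [folklore] -/
theorem igrad_cutComp (μ ν : Fin d) (v : {b // starReg n M S b} → ℂ) (y : {b // starReg n M S b}) :
    igrad M S n μ (cutComp n M S ν v) y = if y.1.2 = ν then igrad M S n μ v y else 0 := by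
  rw [igrad_apply, igrad_apply]
  unfold cutComp
  by_cases h : starReg n M S (y.1.1 + unitVec (fine n M) μ, y.1.2)
  · rw [dif_pos h, dif_pos h]
    by_cases hν : y.1.2 = ν
    · simp only [hν, if_true]
    · simp only [hν, if_false, sub_zero, mul_zero]
  · rw [dif_neg h, dif_neg h]
    split_ifs <;> rfl

/-- **`‖∂_μ z_ν‖² ≤ ‖igrad_μ v‖² + n²·Σ_b tcnt μ b‖v b‖²`** for `μ ≠ ν` (any region): gen 7's `nsq_fdiff_ext_eq` on the cut-off field (on
component `ν ≠ μ` the per-direction charge `cnt1 μ` IS the transverse charge `tcnt μ`). [folklore] -/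
theorem nsq_sdiff_zext_le {μ ν : Fin d} (hμν : μ ≠ ν) (v : {b // starReg n M S b} → ℂ) :
    nsq (sdiff (fine n M) (n : ℂ) μ *ᵥ zext n M S ν v)
      ≤ nsq (igrad M S n μ v) + (n : ℝ) ^ 2 * ∑ b : {b // starReg n M S b}, tcnt n M S μ b.1 * ‖v b‖ ^ 2 := by
  rw [← nsq_fdiff_ext_cutComp, nsq_fdiff_ext_eq]
  have h1 : nsq (igrad M S n μ (cutComp n M S ν v)) ≤ nsq (igrad M S n μ v) := by
    unfold nsq
    refine sum_le_sum fun y _ => ?_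
    rw [igrad_cutComp]
    split_ifs
    · exact le_rfl
    · rw [norm_zero, zero_pow two_ne_zero]; positivity
  have h2 : ∑ y : {b // starReg n M S b},
      ((if starReg n M S (y.1.1 + unitVec (fine n M) μ, y.1.2) then (0 : ℝ) else ‖cutComp n M S ν v y‖ ^ 2)
        + (if starReg n M S (y.1.1 - unitVec (fine n M) μ, y.1.2) then (0 : ℝ) else ‖cutComp n M S ν v y‖ ^ 2))
      ≤ ∑ b : {b // starReg n M S b}, tcnt n M S μ b.1 * ‖v b‖ ^ 2 := by
    refine sum_le_sum fun y _ => ?_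
    by_cases hν : y.1.2 = ν
    · have hne : ¬ y.1.2 = μ := by rw [hν]; exact hμν.symm
      have ht : tcnt n M S μ y.1 = RegionElectricSplitting.cnt1 n M S μ y.1 := by unfold tcnt; rw [if_neg hne]
      rw [ht]
      unfold cutComp RegionElectricSplitting.cnt1
      rw [if_pos hν]
      split_ifs <;> nlinarith [sq_nonneg ‖v y‖]
    · unfold cutComp
      rw [if_neg hν, norm_zero, zero_pow two_ne_zero, ite_self, ite_self, add_zero]
      exact mul_nonneg (tcnt_nonneg n M S μ y.1) (sq_nonneg _)
  have hn : 0 ≤ (n : ℝ) ^ 2 := sq_nonneg _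
  nlinarith [mul_le_mul_of_nonneg_left h2 hn]

/-- **THE OWN-DIRECTION MASKED GRADIENT**: `Σ_x [x ∈ starSite ν ∧ x + e_ν ∈ starSite ν]·‖(∂_ν z_ν)(x)‖² ≤ ‖igrad_ν v‖²` (any region; the interior
pairs of the ν-lines of the carrier are exactly the pairs `igrad_ν` differentiates). [folklore] -/
theorem sum_mask_sdiff_zext_le (ν : Fin d) (v : {b // starReg n M S b} → ℂ) :
    ∑ x, (if starSite n M S ν x ∧ starSite n M S ν (x + unitVec (fine n M) ν) then ‖(sdiff (fine n M) (n : ℂ) ν *ᵥ zext n M S ν v) x‖ ^ 2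
      else 0) ≤ nsq (igrad M S n ν v) := by
  have h1 : ∑ x, (if starSite n M S ν x ∧ starSite n M S ν (x + unitVec (fine n M) ν)
        then ‖(sdiff (fine n M) (n : ℂ) ν *ᵥ zext n M S ν v) x‖ ^ 2 else 0)
      = ∑ x ∈ univ.filter (starSite n M S ν), (if starSite n M S ν (x + unitVec (fine n M) ν)
        then ‖(sdiff (fine n M) (n : ℂ) ν *ᵥ zext n M S ν v) x‖ ^ 2 else 0) := by
    rw [sum_filter]
    refine sum_congr rfl fun x _ => ?_
    by_cases hx : starSite n M S ν x
    · simp only [hx, true_and, if_true]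
    · simp only [hx, false_and, if_false]
  rw [h1, sum_starSite_eq n M S ν (fun c => if starSite n M S ν (c.1 + unitVec (fine n M) ν)
    then ‖(sdiff (fine n M) (n : ℂ) ν *ᵥ zext n M S ν v) c.1‖ ^ 2 else 0)]
  unfold nsq
  refine sum_le_sum fun y _ => ?_
  obtain ⟨⟨x, ν'⟩, hy⟩ := y
  by_cases hν : ν' = ν
  · subst hν
    rw [if_pos rfl]
    by_cases hs : starSite n M S ν' (x + unitVec (fine n M) ν')
    · have hs' : starReg n M S (x + unitVec (fine n M) ν', ν') := hs
      rw [if_pos hs, igrad_apply, dif_pos hs', sdiff_mulVec, zext_apply_of n M S ν' v hs', zext_apply_of n M S ν' v hy]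
    · rw [if_neg hs]; positivity
  · rw [if_neg hν]; positivity

/-! ## §2 Under H1: the per-component scalar budgets against the local form and the directional Hessian -/

/-- one direction of the electric form is dominated by the local form (H1, `0 ≤ a`):
`‖igrad_μ v‖² + n²·Σ_b tcnt μ b‖v b‖² ≤ re⟨v, Δ_loc v⟩`. [folklore] -/
theorem dir_le_form_loc (hH : AtMostOneNeighbour n M S) {a : ℝ} (ha : 0 ≤ a) (μ : Fin d) (v : {b // starReg n M S b} → ℂ) :
    nsq (igrad M S n μ v) + (n : ℝ) ^ 2 * ∑ b : {b // starReg n M S b}, tcnt n M S μ b.1 * ‖v b‖ ^ 2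
      ≤ (star v ⬝ᵥ (regionDeltaLoc n M a S *ᵥ v)).re := by
  rw [form_regionDeltaLoc_electric n M S hH]
  have h1 := single_le_sum (f := fun μ' => nsq (igrad M S n μ' v)
      + (n : ℝ) ^ 2 * ∑ b : {b // starReg n M S b}, tcnt n M S μ' b.1 * ‖v b‖ ^ 2)
    (fun μ' _ => add_nonneg (nsq_nonneg _)
      (mul_nonneg (sq_nonneg _) (sum_nonneg fun b _ => mul_nonneg (tcnt_nonneg n M S μ' b.1) (sq_nonneg _)))) (mem_univ μ)
  have := nsq_nonneg (avgR n M S *ᵥ v)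
  have : 0 ≤ a * (n : ℝ) ^ d * nsq (avgR n M S *ᵥ v) := by positivity
  linarith

/-- **THE TRANSVERSE BUDGET OF A COMPONENT IS DOMINATED BY THE LOCAL FORM PLUS THE DIRECTIONAL HESSIAN** (H1, `0 ≤ a`, `μ ≠ ν`):
`‖∂_μ z_ν‖² + Σ_{x ∈ starSite ν} ‖P_μ z_ν (x)‖² ≤ re⟨v, Δ_loc v⟩ + ‖W_μ v‖²` — leaf-03-g8's `budgetOn (starSite ν) n μ z_ν` against a sub-sum of the
owner's O15-c `Ebud`. [folklore] -/
theorem budget_transverse_le (hH : AtMostOneNeighbour n M S) {a : ℝ} (ha : 0 ≤ a) {μ ν : Fin d} (hμν : μ ≠ ν)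
    (v : {b // starReg n M S b} → ℂ) :
    nsq (sdiff (fine n M) (n : ℂ) μ *ᵥ zext n M S ν v)
        + ∑ x ∈ univ.filter (starSite n M S ν), ‖(Pdir (fine n M) (n : ℂ) μ *ᵥ zext n M S ν v) x‖ ^ 2
      ≤ (star v ⬝ᵥ (regionDeltaLoc n M a S *ᵥ v)).re + nsq (Wdir n M S μ *ᵥ v) := by
  have h1 := nsq_sdiff_zext_le n M S hμν v
  have h2 := sum_starSite_Pdir_sq_le n M S hμν v
  have h3 := dir_le_form_loc n M S hH ha μ v
  linarith

/-- **THE OWN-DIRECTION (NEUMANN) GRADIENT BUDGET OF A COMPONENT IS DOMINATED BY THE LOCAL FORM** (H1, `0 ≤ a`):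
`Σ_x [x, x + e_ν ∈ starSite ν]·‖∂_ν z_ν (x)‖² ≤ re⟨v, Δ_loc v⟩` (the owner's `interiorW2_loc`, constant 1). [folklore] -/
theorem budget_own_le (hH : AtMostOneNeighbour n M S) {a : ℝ} (ha : 0 ≤ a) (ν : Fin d) (v : {b // starReg n M S b} → ℂ) :
    ∑ x, (if starSite n M S ν x ∧ starSite n M S ν (x + unitVec (fine n M) ν) then ‖(sdiff (fine n M) (n : ℂ) ν *ᵥ zext n M S ν v) x‖ ^ 2
      else 0) ≤ (star v ⬝ᵥ (regionDeltaLoc n M a S *ᵥ v)).re := by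
  refine (sum_mask_sdiff_zext_le n M S ν v).trans ?_
  refine le_trans ?_ (interiorW2_loc n M a S hH ha v)
  exact single_le_sum (f := fun μ => nsq (igrad M S n μ v)) (fun μ _ => nsq_nonneg _) (mem_univ ν)

end Region

end Summit.QuantumFields.BalabanUV.T4Continuum.RegionElectricDictionary

end
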